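import Summits.Ventures.PercRepro.S1EightFiveThreeFive

/-!
# PercRepro — THE `(4, 4)` SPLIT AT `(8, 4)`: A SIMPLE COLOOP-FREE RANK-4 PART ON 7 POINTS ⊕ A SIMPLE COLOOP-FREE
RANK-4 PART ON 6 POINTS (p2, gen 28; SUBCLAIM-S1 §6.10 (xvii)(l))

The tightest shape of the `(8, 5)` cell. `#U = N_M(4, 2) N_N(4, 2) + N_M(4, 3) N_N(4, 1) ≤ 35 · 15 + 35 · 6 = 735`
(`N_M(4, 2) ≤ 21 + #(rank-2 triples of M) ≤ 35` — the closure of a pair of `M` has `≤ 4` points, so each pair lies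
in at most `2` rank-`2` triples and `3 t ≤ 2 · 21`; `N_N(4, 2) ≤ C(6, 4)`, `N_N(4, 1) ≤ 6`, `N_M(4, 3) ≤ C(7, 4)`),
so `Φ(8, 4) · #U ≤ 3724`; and `#Y ≥ f_M(1) f_N(4) + f_M(2) (f_N(3) + f_N(4)) + f_M(3) (f_N(2) + f_N(3) + f_N(4))
+ f_M(4) (f_N(1) + f_N(2) + f_N(3)) ≥ 49 + 21 · 22 + 42 f_M(3) + 41 f_M(4) ≥ 511 + 41 · 78 + 21 = 3730` with
`f_M(3) + f_M(4) ≥ 78`, `f_M(3) ≥ 21`, `f_N(3) ≥ 15`, `f_N(2) + f_N(3) ≥ 35`, `f_N(4) ≥ 7`, `f_N(1) ≥ 6`,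
`f_M(2) ≥ 21`, `f_M(1) ≥ 7`. Margin `6`. Nothing is claimed about any cell.

* `ncard_profileSet_four_two_le_add_triples`, `ncard_rankSet_three_ge_rank_four_seven`,
  `ncard_rankSet_three_ge_rank_four_six`, `ncard_rankSet_two_add_three_ge_of_pairs_four`;
* `c025_eight_four_disjointSum_four_four`.
Axioms: standard.
-/

open scoped Matroid

namespace PercRepro

namespace S1

open Set

variable {α : Type}

/-- `N_M(4, 2) ≤ C(7, 5) + #(rank-2 triples)` on `7` points of rank `4`: a spanning set whose complement has
rank `2` has `5` points (complement a pair) or `4` points (complement a rank-`2` triple). -/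
theorem ncard_profileSet_four_two_le_add_triples (M : Matroid α) [M.Finite] (hE : M.E.ncard = 7) :
    (profileSet M 4 2).ncard ≤ 21 + (rankTwoTriples M).ncard := by
  have hfin5 : {A : Set α | A ⊆ M.E ∧ A.ncard = 5}.Finite :=
    M.ground_finite.finite_subsets.subset (fun _ hA => hA.1)
  have hsub : profileSet M 4 2 ⊆ {A : Set α | A ⊆ M.E ∧ A.ncard = 5} ∪ (fun T => M.E \ T) '' rankTwoTriples M := by
    rintro A ⟨hAE, hA4, hAc⟩
    have hAfin : A.Finite := M.ground_finite.subset hAE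
    have h1 : ((4 : ℕ) : ℕ∞) ≤ (A.ncard : ℕ∞) := by
      rw [← hA4, hAfin.cast_ncard_eq]; exact M.eRk_le_encard A
    have h2 : ((2 : ℕ) : ℕ∞) ≤ ((M.E \ A).ncard : ℕ∞) := by
      rw [← hAc, (M.ground_finite.subset sdiff_subset).cast_ncard_eq]; exact M.eRk_le_encard _
    have h3 : A.ncard + (M.E \ A).ncard = M.E.ncard := by
      rw [← ncard_union_eq disjoint_sdiff_right hAfin (M.ground_finite.subset sdiff_subset), union_sdiff_cancel hAE]
    have h1' : 4 ≤ A.ncard := by exact_mod_cast h1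
    have h2' : 2 ≤ (M.E \ A).ncard := by exact_mod_cast h2
    rcases Nat.lt_or_ge A.ncard 5 with h | h
    · right
      refine ⟨M.E \ A, ⟨sdiff_subset, by omega, hAc⟩, ?_⟩
      exact sdiff_sdiff_cancel_left hAE
    · left
      exact ⟨hAE, by omega⟩
  have h := ncard_le_ncard hsub (hfin5.union ((rankTwoTriples_finite M).image _))
  refine h.trans ((ncard_union_le _ _).trans ?_)
  rw [ncard_setOf_subset_ncard_eq M.ground_finite 5, hE, show Nat.choose 7 5 = 21 by decide]
  exact Nat.add_le_add_left (ncard_image_le (rankTwoTriples_finite M)) _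

/-- The `3`-sets that are not rank-`2` triples have rank `3` (all pairs of rank `2`): `C(|E|, 3) − #triples ≤ f(3)`. -/
theorem choose_sub_ncard_rankTwoTriples_le_ncard_rankSet_three (M : Matroid α) [M.Finite]
    (hpairs : ∀ e ∈ M.E, ∀ f ∈ M.E, e ≠ f → M.eRk {e, f} = 2) :
    Nat.choose M.E.ncard 3 - (rankTwoTriples M).ncard ≤ (rankSet M 3).ncard := by
  have hTsub : rankTwoTriples M ⊆ {A : Set α | A ⊆ M.E ∧ A.ncard = 3} := fun T hT => ⟨hT.1, hT.2.1⟩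
  have hsub : {A : Set α | A ⊆ M.E ∧ A.ncard = 3} \ rankTwoTriples M ⊆ rankSet M 3 := by
    rintro A ⟨⟨hAE, hA3⟩, hAT⟩
    refine ⟨hAE, ?_⟩
    have hhi : M.eRk A ≤ 3 := by
      have := M.eRk_le_encard A
      rwa [← (M.ground_finite.subset hAE).cast_ncard_eq, hA3] at this
    have hlo := two_le_eRk_of_two_le_ncard hpairs hAE (by omega)
    obtain ⟨n, hn⟩ := ENat.ne_top_iff_exists.mp (ne_top_of_le_ne_top (by decide) hhi)
    rw [← hn] at hlo hhi ⊢
    have hlo' : 2 ≤ n := by exact_mod_cast hlo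
    have hhi' : n ≤ 3 := by exact_mod_cast hhi
    rcases Nat.lt_or_ge n 3 with h | h
    · exfalso
      apply hAT
      refine ⟨hAE, hA3, ?_⟩
      rw [← hn]
      have : n = 2 := by omega
      rw [this]; rfl
    · have : n = 3 := by omega
      rw [this]
  have h := ncard_le_ncard hsub (rankSet_finite M 3)
  rwa [ncard_sdiff hTsub (rankTwoTriples_finite M), ncard_setOf_subset_ncard_eq M.ground_finite 3] at h

/-- `f(3) ≥ 21` for a coloop-free matroid of rank `4` on `7` points with all pairs of rank `2`: at most `14` of
the `35` three-sets are rank-`2` triples (each pair lies in at most `2`). -/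
theorem ncard_rankSet_three_ge_rank_four_seven (M : Matroid α) [M.Finite] (hM : M.eRank = ((4 : ℕ) : ℕ∞))
    (hE : M.E.ncard = 7) (hcol : M.coloops = ∅) (hpairs : ∀ e ∈ M.E, ∀ f ∈ M.E, e ≠ f → M.eRk {e, f} = 2) :
    21 ≤ (rankSet M 3).ncard ∧ (rankTwoTriples M).ncard ≤ 14 := by
  have hcl : ∀ x ∈ M.E, ∀ y ∈ M.E, x ≠ y → (M.closure {x, y}).ncard ≤ 2 + 2 := by
    intro x hx y hy hxy
    have := ncard_closure_pair_le_of_coloops' M hM (by norm_num) hcol hpairs hx hy hxy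
    rw [hE] at this
    omega
  have ht := three_mul_ncard_rankTwoTriples_le_of_closure M hpairs hcl
  rw [hE, show Nat.choose 7 2 = 21 by decide] at ht
  have h := choose_sub_ncard_rankTwoTriples_le_ncard_rankSet_three M hpairs
  rw [hE, show Nat.choose 7 3 = 35 by decide] at h
  omega

/-- `f(3) ≥ 15` for a coloop-free matroid of rank `4` on `6` points with all pairs of rank `2`: at most `5` of
the `20` three-sets are rank-`2` triples (the closure of a pair has `≤ 3` points). -/
theorem ncard_rankSet_three_ge_rank_four_six (N : Matroid α) [N.Finite] (hN : N.eRank = ((4 : ℕ) : ℕ∞))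
    (hE : N.E.ncard = 6) (hcol : N.coloops = ∅) (hpairs : ∀ e ∈ N.E, ∀ f ∈ N.E, e ≠ f → N.eRk {e, f} = 2) :
    15 ≤ (rankSet N 3).ncard := by
  have hcl : ∀ x ∈ N.E, ∀ y ∈ N.E, x ≠ y → (N.closure {x, y}).ncard ≤ 1 + 2 := by
    intro x hx y hy hxy
    have := ncard_closure_pair_le_of_coloops' N hN (by norm_num) hcol hpairs hx hy hxy
    rw [hE] at this
    omega
  have ht := three_mul_ncard_rankTwoTriples_le_of_closure N hpairs hcl
  rw [hE, show Nat.choose 6 2 = 15 by decide] at ht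
  have h := choose_sub_ncard_rankTwoTriples_le_ncard_rankSet_three N hpairs
  rw [hE, show Nat.choose 6 3 = 20 by decide] at h
  omega

/-- `f(2) + f(3) ≥ C(|E|, 2) + C(|E|, 3)` when all pairs have rank `2` and the rank is at least `3`... stated for
rank `4`: every pair has rank `2`, every `3`-set rank `2` or `3`. -/
theorem ncard_rankSet_two_add_three_ge_of_pairs_four (N : Matroid α) [N.Finite]
    (hpairs : ∀ e ∈ N.E, ∀ f ∈ N.E, e ≠ f → N.eRk {e, f} = 2) :
    Nat.choose N.E.ncard 2 + Nat.choose N.E.ncard 3 ≤ (rankSet N 2).ncard + (rankSet N 3).ncard := by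
  have hsub : {A : Set α | A ⊆ N.E ∧ A.ncard = 2} ∪ {A : Set α | A ⊆ N.E ∧ A.ncard = 3} ⊆
      rankSet N 2 ∪ rankSet N 3 := by
    rintro A (⟨hAE, h2⟩ | ⟨hAE, h3⟩)
    · left
      refine ⟨hAE, ?_⟩
      obtain ⟨x, y, hxy, rfl⟩ := ncard_eq_two.mp h2
      rw [hpairs x (hAE (by simp)) y (hAE (by simp)) hxy]; rfl
    · have hhi : N.eRk A ≤ 3 := by
        have := N.eRk_le_encard A
        rwa [← (N.ground_finite.subset hAE).cast_ncard_eq, h3] at this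
      have hlo := two_le_eRk_of_two_le_ncard hpairs hAE (by omega)
      obtain ⟨n, hn⟩ := ENat.ne_top_iff_exists.mp (ne_top_of_le_ne_top (by decide) hhi)
      rw [← hn] at hlo hhi
      have hlo' : 2 ≤ n := by exact_mod_cast hlo
      have hhi' : n ≤ 3 := by exact_mod_cast hhi
      have hmem : ∀ k, n = k → A ∈ rankSet N k := fun k hk => ⟨hAE, by rw [← hn, hk]⟩
      rcases Nat.lt_or_ge n 3 with h | h
      · exact Or.inl (hmem 2 (by omega))
      · exact Or.inr (hmem 3 (by omega))
  have hf : ∀ k : ℕ, {A : Set α | A ⊆ N.E ∧ A.ncard = k}.Finite := fun k =>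
    N.ground_finite.finite_subsets.subset (fun _ hA => hA.1)
  have h := ncard_le_ncard hsub ((rankSet_finite N 2).union (rankSet_finite N 3))
  rwa [ncard_union_eq (by rw [Set.disjoint_left]; rintro A ⟨-, h⟩ ⟨-, h'⟩; omega) (hf 2) (hf 3),
    ncard_setOf_subset_ncard_eq N.ground_finite 2, ncard_setOf_subset_ncard_eq N.ground_finite 3,
    ncard_union_eq (rankSet_disjoint_of_ne N (by norm_num)) (rankSet_finite N 2) (rankSet_finite N 3)] at h

/-- The arithmetic of the `(4, 4)`-split consumer at `(8, 4)`: `u ≤ 735`, `y ≥ 3730`. -/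
theorem consumer_arith_four_four_eight {u y : ℚ} (hU : u ≤ 735) (hY : 3730 ≤ y) : 76 / 15 * u ≤ y := by
  linarith

/-- **The `(4, 4)`-split consumer at `(8, 4)`**: `M` coloop-free of rank `4` on `7` points and `N` coloop-free of
rank `4` on `6` points, both with all pairs of rank `2`. -/
theorem c025_eight_four_disjointSum_four_four (M N : Matroid α) [M.Finite] [N.Finite] (h : Disjoint M.E N.E)
    (hM : M.eRank = ((4 : ℕ) : ℕ∞)) (hME : M.E.ncard = 7) (hcolM : M.coloops = ∅)
    (hpairsM : ∀ e ∈ M.E, ∀ f ∈ M.E, e ≠ f → M.eRk {e, f} = 2) (hN : N.eRank = ((4 : ℕ) : ℕ∞))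
    (hNE : N.E.ncard = 6) (hcolN : N.coloops = ∅) (hpairsN : ∀ e ∈ N.E, ∀ f ∈ N.E, e ≠ f → N.eRk {e, f} = 2) :
    phiK 8 4 * ({A : Set α | A ⊆ (M.disjointSum N h).E ∧ (M.disjointSum N h).eRk A = ((8 : ℕ) : ℕ∞) ∧
        (M.disjointSum N h).eRk ((M.disjointSum N h).E \ A) = ((4 : ℕ) : ℕ∞)}.ncard : ℚ) ≤
      ({A : Set α | A ⊆ (M.disjointSum N h).E ∧ ((4 : ℕ) : ℕ∞) < (M.disjointSum N h).eRk A ∧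
        (M.disjointSum N h).eRk A < ((8 : ℕ) : ℕ∞)}.ncard : ℚ) := by
  obtain ⟨hF3, hT⟩ := ncard_rankSet_three_ge_rank_four_seven M hM hME hcolM hpairsM
  -- the `U`-side
  have hU : {A : Set α | A ⊆ (M.disjointSum N h).E ∧ (M.disjointSum N h).eRk A = ((8 : ℕ) : ℕ∞) ∧
      (M.disjointSum N h).eRk ((M.disjointSum N h).E \ A) = ((4 : ℕ) : ℕ∞)}.ncard ≤ 735 := by
    rw [disjointSum_ncard_U_eq_finsum M N h 8 4, finsum_mem_coe_finset]
    rw [Finset.sum_eq_add_of_mem (4, 2) (4, 3) (by decide) (by decide) (by decide) ?_]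
    · dsimp only
      show (profileSet M 4 2).ncard * (profileSet N 4 2).ncard + (profileSet M 4 3).ncard * (profileSet N 4 1).ncard ≤ _
      have h42 := ncard_profileSet_four_two_le_add_triples M hME
      have h42' : (profileSet M 4 2).ncard ≤ 35 := by omega
      have h43 := ncard_profileSet_le_choose_of_ncard_eq (N := M) (a := 4) (b := 3) hME
      rw [show Nat.choose (4 + 3) 4 = 35 by decide] at h43
      have g42 := ncard_profileSet_le_choose_of_ncard_eq (N := N) (a := 4) (b := 2) hNE
      rw [show Nat.choose (4 + 2) 4 = 15 by decide] at g42
      have g41 := ncard_profileSet_top_one_le_of_pairs' hpairsN 4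
      rw [hNE] at g41
      calc (profileSet M 4 2).ncard * (profileSet N 4 2).ncard + (profileSet M 4 3).ncard * (profileSet N 4 1).ncard
          ≤ 35 * 15 + 35 * 6 := Nat.add_le_add (Nat.mul_le_mul h42' g42) (Nat.mul_le_mul h43 g41)
        _ = 735 := by norm_num
    · rintro ⟨a, b⟩ hmem ⟨hne1, hne2⟩
      rw [Finset.mem_product, Finset.mem_range, Finset.mem_range] at hmem
      dsimp only
      rcases Nat.lt_or_ge 4 a with ha | ha
      · rw [profileSet_eq_empty_of_eRank_lt M hM ha b, ncard_empty, zero_mul]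
      rcases Nat.lt_or_ge a 4 with ha' | ha'
      · have h8a : 4 < 8 - a := by omega
        rw [profileSet_eq_empty_of_eRank_lt N hN h8a (4 - b), ncard_empty, mul_zero]
      have ha4 : a = 4 := by omega
      subst ha4
      rw [show (8 : ℕ) - 4 = 4 from rfl]
      rcases Nat.lt_or_ge b 2 with hb | hb
      · have h6 : N.E.ncard < 4 + (4 - b) := by rw [hNE]; omega
        rw [profileSet_eq_empty_of_ncard_lt N h6, ncard_empty, mul_zero]
      · have hb4 : b = 4 := by
          rcases Nat.lt_or_ge b 4 with hb4 | hb4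
          · exfalso
            rcases Nat.lt_or_ge b 3 with hb3 | hb3
            · exact hne1 (by congr 1; omega)
            · exact hne2 (by congr 1; omega)
          · omega
        subst hb4
        rw [profileSet_eq_empty_of_ncard_lt M (by rw [hME]; norm_num : M.E.ncard < 4 + 4), ncard_empty, zero_mul]
  -- the `Y`-side
  have hY : 3730 ≤ {A : Set α | A ⊆ (M.disjointSum N h).E ∧ ((4 : ℕ) : ℕ∞) < (M.disjointSum N h).eRk A ∧
        (M.disjointSum N h).eRk A < ((8 : ℕ) : ℕ∞)}.ncard := by
    rw [disjointSum_ncard_Y_eq_finsum M N h 8 4, finsum_mem_coe_finset]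
    have hsub : ({(1, 4), (2, 3), (2, 4), (3, 2), (3, 3), (3, 4), (4, 1), (4, 2), (4, 3)} : Finset (ℕ × ℕ)) ⊆
        (Finset.range 8 ×ˢ Finset.range 8).filter (fun x : ℕ × ℕ => 4 < x.1 + x.2 ∧ x.1 + x.2 < 8) := by
      decide
    refine le_trans ?_ (Finset.sum_le_sum_of_subset hsub)
    rw [Finset.sum_insert (by decide), Finset.sum_insert (by decide), Finset.sum_insert (by decide),
      Finset.sum_insert (by decide), Finset.sum_insert (by decide), Finset.sum_insert (by decide),
      Finset.sum_insert (by decide), Finset.sum_insert (by decide), Finset.sum_singleton]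
    dsimp only
    -- the `M`-side counts
    have hcl : ∀ x ∈ M.E, ∀ y ∈ M.E, x ≠ y → (M.closure {x, y}).ncard ≤ 4 := by
      intro x hx y hy hxy
      have := ncard_closure_pair_le_of_coloops' M hM (by norm_num) hcolM hpairsM hx hy hxy
      rw [hME] at this
      omega
    have hbig := ncard_bigRankTwo_le_choose M hpairsM hcl
    rw [hME, show Nat.choose 7 2 = 21 by decide] at hbig
    have hF2hi := ncard_rankSet_two_le_add_big M
    rw [hME, show Nat.choose 7 2 = 21 by decide] at hF2hi
    have hF234 := ncard_rankSet_two_three_four_ge_of_pairs M hM hpairsM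
    rw [hME, show 2 ^ 7 - 1 - 7 = 120 by decide] at hF234
    have hG : 78 ≤ (rankSet M 3).ncard + (rankSet M 4).ncard := by omega
    have F2 : 21 ≤ (rankSet M 2).ncard := by
      have := choose_le_ncard_rankSet_two_of_pairs hpairsM
      rwa [hME, show Nat.choose 7 2 = 21 by decide] at this
    have F1 : 7 ≤ (rankSet M 1).ncard := by
      have := ncard_le_ncard_rankSet_one_of_pairs hpairsM (by omega)
      rwa [hME] at this
    -- the `N`-side counts
    have G1 : 6 ≤ (rankSet N 1).ncard := by
      have := ncard_le_ncard_rankSet_one_of_pairs hpairsN (by omega)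
      rwa [hNE] at this
    have G23 : 35 ≤ (rankSet N 2).ncard + (rankSet N 3).ncard := by
      have := ncard_rankSet_two_add_three_ge_of_pairs_four N hpairsN
      rwa [hNE, show Nat.choose 6 2 = 15 by decide, show Nat.choose 6 3 = 20 by decide] at this
    have G3 := ncard_rankSet_three_ge_rank_four_six N hN hNE hcolN hpairsN
    have G4 : 7 ≤ (rankSet N 4).ncard := by
      have := succ_le_ncard_rankSet_top_of_coloops N hN hcolN
      rwa [hNE] at this
    -- the product bounds
    have e14 := Nat.mul_le_mul F1 G4
    have e23 := Nat.mul_le_mul F2 G3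
    have e24 := Nat.mul_le_mul F2 G4
    have e3 : (rankSet M 3).ncard * 42 ≤ (rankSet M 3).ncard * (rankSet N 2).ncard +
        (rankSet M 3).ncard * (rankSet N 3).ncard + (rankSet M 3).ncard * (rankSet N 4).ncard := by
      rw [← mul_add, ← mul_add]
      exact Nat.mul_le_mul_left _ (by omega)
    have e4 : (rankSet M 4).ncard * 41 ≤ (rankSet M 4).ncard * (rankSet N 1).ncard +
        (rankSet M 4).ncard * (rankSet N 2).ncard + (rankSet M 4).ncard * (rankSet N 3).ncard := by
      rw [← mul_add, ← mul_add]
      exact Nat.mul_le_mul_left _ (by omega)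
    nlinarith [e14, e23, e24, e3, e4, hG, hF3]
  rw [phiK_eight_four]
  have hU' : (({A : Set α | A ⊆ (M.disjointSum N h).E ∧ (M.disjointSum N h).eRk A = ((8 : ℕ) : ℕ∞) ∧
      (M.disjointSum N h).eRk ((M.disjointSum N h).E \ A) = ((4 : ℕ) : ℕ∞)}.ncard : ℕ) : ℚ) ≤ 735 := by
    exact_mod_cast hU
  have hY' : (3730 : ℚ) ≤ (({A : Set α | A ⊆ (M.disjointSum N h).E ∧ ((4 : ℕ) : ℕ∞) < (M.disjointSum N h).eRk A ∧
        (M.disjointSum N h).eRk A < ((8 : ℕ) : ℕ∞)}.ncard : ℕ) : ℚ) := by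
    exact_mod_cast hY
  exact consumer_arith_four_four_eight hU' hY'

end S1

end PercRepro
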